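import Summits.Ventures.HSemireg.WedgeHankelRecurrenceGaussOneSided

/-!
# Venture HSemireg — **THE CHEBYSHEV–MARKOV–STIELTJES SEPARATION INEQUALITIES**: if `Σ_{j ≤ t} μ_j x_j^p = Σ_l ν_l w_l^p` for `p ≤ 2t` (`x_0 < ⋯ < x_t`, `ν_l ≥ 0`), then for every node `x_k`
# `μ_0 + ⋯ + μ_{k−1} ≤ ν(w < x_k) ≤ ν(w ≤ x_k) ≤ μ_0 + ⋯ + μ_k` — the distribution function of ANY non-negative representation of `s_0, …, s_{2t}` is pinched at the Gauss nodes by the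
# partial sums of the Christoffel numbers; COROLLARIES: the atom of `ν` at `x_k` is at most `μ_k`, and `Σ_{a < j < b} μ_j ≤ ν(x_a < w < x_b)`; Markov's proof via the one-sided
# interpolation polynomial of N270 and its reflection `S(y) = 1 − R̃(−y)` (Li's Thm 5)

HONEST FRAMING. Part of the Lean index of the computation cell `pub-hsemireg` (seat p10 gen 42, Sunday typer «UNIFORM-IN-n»).  Real polynomials and finite sums only, on top of N262 ∕ N270;
no variety, no cohomology theory, no sheaf, no Ext group and no semiregularity map is constructed here; nothing here says that HC / HC_CM / HC_AV holds; no Literature fact (unproved `Prop`) is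
declared or used.  Custodian versions as in `WedgeHankelSiegelIdeal` (1/3).
SOURCES (cited).  G. Szegő, *Orthogonal Polynomials*, AMS Colloq. Publ. 23, §3.41 «Separation theorem of Chebyshev–Markov–Stieltjes», Thm 3.41.1 (conjectured by Chebyshev 1874, proved by
A. Markov and by Stieltjes, 1884) with §3.411 (Markov's proof); N. I. Akhiezer, *The Classical Moment Problem* (1965), Ch. II §5; M. G. Krein, A. A. Nudel'man, *The Markov Moment Problem
and Extremal Problems* (1977), Ch. III §2 (Chebyshev–Markov inequalities for canonical representations); Xin Li, in: W. B. Jones (ed.), *Orthogonal Functions, Moment Theory, and Continued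
Fractions* (Dekker, 1998), Thm 1 (4) and §4 (held `book:editornd-orthogonal-functions` pp. 327–335).  This closes gen 41 OPEN item (d) of this lineage.
PROOF TYPED HERE.  With `R ≥ 𝟙_{(−∞, x_k]}`, `R(x_j) = [j ≤ k]`, `deg R ≤ 2t` (N270): `Σ_{j ≤ k} μ_j = Σ_j μ_j R(x_j) = Σ_l ν_l R(w_l) ≥ Σ_{w_l ≤ x_k} ν_l`.  With the reflected nodes `−x_{t−j}`
and index `t − k`, N270 gives `R̃`; `S = 1 − R̃(−X)` has `S(x_j) = [j < k]`, `S ≤ 1`, `S ≤ 0` on `[x_k, ∞)`, whence `Σ_{j < k} μ_j = Σ_l ν_l S(w_l) ≤ Σ_{w_l < x_k} ν_l`.  The corollaries are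
differences of these.
DEDUP DISCLOSURE (`rg -n 'Stieltjes|separation' Summits/Ventures/HSemireg/WedgeHankelRecurrence*`, 2026-09-02): `StieltjesFraction` ∕ `StieltjesHurwitz` are continued fractions; nothing on the
separation theorem.  The 7 names below: 0 hits tree-wide.

WHAT IS IN THE TREE.  N262 `sum_mul_eval_eq_of_moments_eq`; N270 `exists_oneSided_poly`; Mathlib `Fin.rev`, `Fin.rev_le_rev`, `Polynomial.natDegree_comp_le`, `Finset.sum_filter`,
`Finset.sum_le_sum`.
THIS FILE (namespace `Summit.Ventures.HSemireg.Wedge.HankelOuter` continued; CHAINED on N270; 0 definitions):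
* §1036 `exists_oneSided_poly_lt` (the reflected polynomial: `deg ≤ 2t`, `S(x_i) = [i < k]`, `S ≤ 1`, `S ≤ 0` on `[x_k, ∞)`), **`cms_mass_le_le_sum_weights_le`** (`ν(w ≤ x_k) ≤ Σ_{j ≤ k} μ_j`),
  **`cms_sum_weights_lt_le_mass_lt`** (`Σ_{j < k} μ_j ≤ ν(w < x_k)`), **`chebyshev_markov_stieltjes`** (the chain `Σ_{j<k} μ_j ≤ ν(w < x_k) ≤ ν(w ≤ x_k) ≤ Σ_{j≤k} μ_j`), `cms_atom_le_weight`
  (`ν(w = x_k) ≤ μ_k`), `cms_sum_weights_between_le_mass_between` (`Σ_{a<j<b} μ_j ≤ ν(x_a < w < x_b)`), `cms_weight_le_mass_between` (`μ_k ≤ ν(x_{k−1} < w < x_{k+1})` for an interior node).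
CAVEATS.  Non-strict inequalities (the integrating representation is discrete and may coincide with the Gauss rule); moments up to `2t` only are used.  Nothing Ext-side.  New names only.
-/

open Module Polynomial
open scoped Matrix Polynomial

namespace Summit.Ventures.HSemireg.Wedge.HankelOuter

/-! ## §1036. The separation theorem -/

/-- **The reflected one-sided polynomial** (Li's Thm 5 for ordinary polynomials): for `x_0 < ⋯ < x_t` and `k ≤ t` there is `S` with `deg S ≤ 2t`, `S(x_i) = 1` (`i < k`), `S(x_i) = 0`
(`i ≥ k`), `S ≤ 1` on `ℝ` and `S ≤ 0` on `[x_k, ∞)`; namely `S = 1 − R̃(−X)` for the one-sided polynomial `R̃` of the nodes `−x_t < ⋯ < −x_0` and the index `t − k`.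
[Li 1998 Thm 5; Szegő §3.411; this file, §1036] -/
theorem exists_oneSided_poly_lt {t : ℕ} {x : Fin (t + 1) → ℝ} (hx : StrictMono x) (k : Fin (t + 1)) :
    ∃ S : ℝ[X], S.natDegree ≤ 2 * t ∧ (∀ i, S.eval (x i) = if i < k then 1 else 0) ∧ (∀ y, S.eval y ≤ 1) ∧ ∀ y, x k ≤ y → S.eval y ≤ 0 := by
  set xr : Fin (t + 1) → ℝ := fun j => -x (Fin.rev j) with hxr
  have hxr_mono : StrictMono xr := fun a b hab => by
    simp only [hxr]
    exact neg_lt_neg (hx (Fin.rev_lt_rev.2 hab))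
  obtain ⟨R, hRdeg, hRval, hRnn, hRone⟩ := exists_oneSided_poly hxr_mono (Fin.rev k)
  refine ⟨1 - R.comp (-Polynomial.X), ?_, fun i => ?_, fun y => ?_, fun y hy => ?_⟩
  · refine (natDegree_sub_le _ _).trans (max_le (by rw [natDegree_one]; exact Nat.zero_le _) ?_)
    refine (natDegree_comp_le).trans ?_
    rw [natDegree_neg, natDegree_X, mul_one]; exact hRdeg
  · rw [eval_sub, eval_one, eval_comp, eval_neg, eval_X]
    have : -x i = xr (Fin.rev i) := by simp only [hxr, Fin.rev_rev]
    rw [this, hRval (Fin.rev i)]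
    by_cases h : i < k
    · rw [if_pos h, if_neg (fun h' => (not_le.2 h) (Fin.rev_le_rev.1 h')), sub_zero]
    · rw [if_neg h, if_pos (Fin.rev_le_rev.2 (not_lt.1 h)), sub_self]
  · rw [eval_sub, eval_one, eval_comp, eval_neg, eval_X, sub_le_self_iff]
    exact hRnn _
  · rw [eval_sub, eval_one, eval_comp, eval_neg, eval_X, sub_nonpos]
    refine hRone _ ?_
    simp only [hxr, Fin.rev_rev]
    exact neg_le_neg hy

/-- **CMS, upper half: `ν(w ≤ x_k) ≤ μ_0 + ⋯ + μ_k`.**  If `Σ_j μ_j x_j^p = Σ_l ν_l w_l^p` for `p ≤ 2t` with `x` strictly increasing and `ν ≥ 0`, then the `ν`-mass of `(−∞, x_k]` is at most the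
partial sum of the Christoffel numbers up to `k`. [Szegő Thm 3.41.1; Krein–Nudel'man III §2; this file, §1036] -/
theorem cms_mass_le_le_sum_weights_le {t N : ℕ} {μ x : Fin (t + 1) → ℝ} {ν w : Fin N → ℝ} (hx : StrictMono x) (hν : ∀ l, 0 ≤ ν l)
    (hmom : ∀ p, p ≤ 2 * t → ∑ j, μ j * x j ^ p = ∑ l, ν l * w l ^ p) (k : Fin (t + 1)) :
    ∑ l ∈ Finset.univ.filter (fun l => w l ≤ x k), ν l ≤ ∑ j ∈ Finset.univ.filter (fun j => j ≤ k), μ j := by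
  obtain ⟨R, hRdeg, hRval, hRnn, hRone⟩ := exists_oneSided_poly hx k
  have hq := sum_mul_eval_eq_of_moments_eq (N := 2 * t + 1) (fun p hp => hmom p (by omega)) (F := R) (by omega)
  have hsmall : ∑ j, μ j * R.eval (x j) = ∑ j ∈ Finset.univ.filter (fun j => j ≤ k), μ j := by
    rw [Finset.sum_filter]
    exact Finset.sum_congr rfl fun j _ => by rw [hRval j]; split_ifs <;> simp
  rw [← hsmall, hq]
  calc ∑ l ∈ Finset.univ.filter (fun l => w l ≤ x k), ν l
      ≤ ∑ l ∈ Finset.univ.filter (fun l => w l ≤ x k), ν l * R.eval (w l) :=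
        Finset.sum_le_sum fun l hl => le_mul_of_one_le_right (hν l) (hRone _ (Finset.mem_filter.1 hl).2)
    _ ≤ ∑ l, ν l * R.eval (w l) :=
        Finset.sum_le_sum_of_subset_of_nonneg (Finset.filter_subset _ _) fun l _ _ => mul_nonneg (hν l) (hRnn _)

/-- **CMS, lower half: `μ_0 + ⋯ + μ_{k−1} ≤ ν(w < x_k)`.** [Szegő Thm 3.41.1; Krein–Nudel'man III §2; this file, §1036] -/
theorem cms_sum_weights_lt_le_mass_lt {t N : ℕ} {μ x : Fin (t + 1) → ℝ} {ν w : Fin N → ℝ} (hx : StrictMono x) (hν : ∀ l, 0 ≤ ν l)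
    (hmom : ∀ p, p ≤ 2 * t → ∑ j, μ j * x j ^ p = ∑ l, ν l * w l ^ p) (k : Fin (t + 1)) :
    ∑ j ∈ Finset.univ.filter (fun j => j < k), μ j ≤ ∑ l ∈ Finset.univ.filter (fun l => w l < x k), ν l := by
  obtain ⟨S, hSdeg, hSval, hSle, hSnp⟩ := exists_oneSided_poly_lt hx k
  have hq := sum_mul_eval_eq_of_moments_eq (N := 2 * t + 1) (fun p hp => hmom p (by omega)) (F := S) (by omega)
  have hsmall : ∑ j, μ j * S.eval (x j) = ∑ j ∈ Finset.univ.filter (fun j => j < k), μ j := by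
    rw [Finset.sum_filter]
    exact Finset.sum_congr rfl fun j _ => by rw [hSval j]; split_ifs <;> simp
  rw [← hsmall, hq, Finset.sum_filter]
  refine Finset.sum_le_sum fun l _ => ?_
  split_ifs with h
  · exact mul_le_of_le_one_right (hν l) (hSle _)
  · exact mul_nonpos_iff.2 (Or.inl ⟨hν l, hSnp _ (not_lt.1 h)⟩)

/-- **THE CHEBYSHEV–MARKOV–STIELTJES SEPARATION THEOREM** (discrete integrating measure, non-strict form): for every Gauss node `x_k`,
`Σ_{j < k} μ_j ≤ ν(w < x_k) ≤ ν(w ≤ x_k) ≤ Σ_{j ≤ k} μ_j`. [Szegő Thm 3.41.1; Akhiezer II §5; Krein–Nudel'man III §2; Li 1998 Thm 1 (4); this file, §1036] -/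
theorem chebyshev_markov_stieltjes {t N : ℕ} {μ x : Fin (t + 1) → ℝ} {ν w : Fin N → ℝ} (hx : StrictMono x) (hν : ∀ l, 0 ≤ ν l)
    (hmom : ∀ p, p ≤ 2 * t → ∑ j, μ j * x j ^ p = ∑ l, ν l * w l ^ p) (k : Fin (t + 1)) :
    ∑ j ∈ Finset.univ.filter (fun j => j < k), μ j ≤ ∑ l ∈ Finset.univ.filter (fun l => w l < x k), ν l ∧
      ∑ l ∈ Finset.univ.filter (fun l => w l < x k), ν l ≤ ∑ l ∈ Finset.univ.filter (fun l => w l ≤ x k), ν l ∧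
        ∑ l ∈ Finset.univ.filter (fun l => w l ≤ x k), ν l ≤ ∑ j ∈ Finset.univ.filter (fun j => j ≤ k), μ j := by
  refine ⟨cms_sum_weights_lt_le_mass_lt hx hν hmom k, ?_, cms_mass_le_le_sum_weights_le hx hν hmom k⟩
  exact Finset.sum_le_sum_of_subset_of_nonneg (fun l hl => Finset.mem_filter.2 ⟨Finset.mem_univ l, (Finset.mem_filter.1 hl).2.le⟩) fun l _ _ => hν l

/-- **Corollary — the atom at a node is dominated by its Christoffel number: `ν(w = x_k) ≤ μ_k`.** [Szegő §3.41; Krein–Nudel'man III §2; this file, §1036] -/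
theorem cms_atom_le_weight {t N : ℕ} {μ x : Fin (t + 1) → ℝ} {ν w : Fin N → ℝ} (hx : StrictMono x) (hν : ∀ l, 0 ≤ ν l)
    (hmom : ∀ p, p ≤ 2 * t → ∑ j, μ j * x j ^ p = ∑ l, ν l * w l ^ p) (k : Fin (t + 1)) :
    ∑ l ∈ Finset.univ.filter (fun l => w l = x k), ν l ≤ μ k := by
  have h1 := cms_mass_le_le_sum_weights_le hx hν hmom k
  have h2 := cms_sum_weights_lt_le_mass_lt hx hν hmom k
  -- split `w ≤ x_k` into `w < x_k` and `w = x_k`, and `j ≤ k` into `j < k` and `j = k`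
  have hbig : ∑ l ∈ Finset.univ.filter (fun l => w l ≤ x k), ν l = ∑ l ∈ Finset.univ.filter (fun l => w l < x k), ν l + ∑ l ∈ Finset.univ.filter (fun l => w l = x k), ν l := by
    rw [Finset.sum_filter, Finset.sum_filter, Finset.sum_filter, ← Finset.sum_add_distrib]
    refine Finset.sum_congr rfl fun l _ => ?_
    rcases lt_trichotomy (w l) (x k) with h | h | h
    · rw [if_pos h.le, if_pos h, if_neg h.ne, add_zero]
    · rw [if_pos h.le, if_neg h.not_lt, if_pos h, zero_add]
    · rw [if_neg (not_le.2 h), if_neg (not_lt.2 h.le), if_neg h.ne', add_zero]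
  have hsmall : ∑ j ∈ Finset.univ.filter (fun j => j ≤ k), μ j = ∑ j ∈ Finset.univ.filter (fun j => j < k), μ j + μ k := by
    rw [Finset.sum_filter, Finset.sum_filter]
    rw [show μ k = ∑ j, if j = k then μ j else 0 by rw [Finset.sum_ite_eq' Finset.univ k]; simp]
    rw [← Finset.sum_add_distrib]
    refine Finset.sum_congr rfl fun j _ => ?_
    rcases lt_trichotomy j k with h | h | h
    · rw [if_pos h.le, if_pos h, if_neg h.ne, add_zero]
    · rw [if_pos h.le, if_neg h.not_lt, if_pos h, zero_add]
    · rw [if_neg (not_le.2 h), if_neg (not_lt.2 h.le), if_neg h.ne', add_zero]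
  rw [hbig, hsmall] at h1
  linarith

/-- **Corollary — `Σ_{a < j < b} μ_j ≤ ν(x_a < w < x_b)`** for node indices `a < b`: the Christoffel numbers strictly between two nodes are carried by the open interval between them.
[Szegő §3.41 (3.41.4); this file, §1036] -/
theorem cms_sum_weights_between_le_mass_between {t N : ℕ} {μ x : Fin (t + 1) → ℝ} {ν w : Fin N → ℝ} (hx : StrictMono x) (hν : ∀ l, 0 ≤ ν l)
    (hmom : ∀ p, p ≤ 2 * t → ∑ j, μ j * x j ^ p = ∑ l, ν l * w l ^ p) {a b : Fin (t + 1)} (hab : a < b) :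
    ∑ j ∈ Finset.univ.filter (fun j => a < j ∧ j < b), μ j ≤ ∑ l ∈ Finset.univ.filter (fun l => x a < w l ∧ w l < x b), ν l := by
  have h1 := cms_mass_le_le_sum_weights_le hx hν hmom a
  have h2 := cms_sum_weights_lt_le_mass_lt hx hν hmom b
  have hxab : x a < x b := hx hab
  have hsmall : ∑ j ∈ Finset.univ.filter (fun j => j < b), μ j = ∑ j ∈ Finset.univ.filter (fun j => j ≤ a), μ j + ∑ j ∈ Finset.univ.filter (fun j => a < j ∧ j < b), μ j := by
    rw [Finset.sum_filter, Finset.sum_filter, Finset.sum_filter, ← Finset.sum_add_distrib]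
    refine Finset.sum_congr rfl fun j _ => ?_
    by_cases hja : j ≤ a
    · rw [if_pos (lt_of_le_of_lt hja hab), if_pos hja, if_neg (fun h => (not_lt.2 hja) h.1), add_zero]
    · by_cases hjb : j < b
      · rw [if_pos hjb, if_neg hja, if_pos ⟨not_le.1 hja, hjb⟩, zero_add]
      · rw [if_neg hjb, if_neg hja, if_neg (fun h => hjb h.2), add_zero]
  have hbig : ∑ l ∈ Finset.univ.filter (fun l => w l < x b), ν l = ∑ l ∈ Finset.univ.filter (fun l => w l ≤ x a), ν l + ∑ l ∈ Finset.univ.filter (fun l => x a < w l ∧ w l < x b), ν l := by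
    rw [Finset.sum_filter, Finset.sum_filter, Finset.sum_filter, ← Finset.sum_add_distrib]
    refine Finset.sum_congr rfl fun l _ => ?_
    by_cases hla : w l ≤ x a
    · rw [if_pos (lt_of_le_of_lt hla hxab), if_pos hla, if_neg (fun h => (not_lt.2 hla) h.1), add_zero]
    · by_cases hlb : w l < x b
      · rw [if_pos hlb, if_neg hla, if_pos ⟨not_le.1 hla, hlb⟩, zero_add]
      · rw [if_neg hlb, if_neg hla, if_neg (fun h => hlb h.2), add_zero]
  rw [hsmall, hbig] at h2
  linarith

/-- **Corollary — `μ_k ≤ ν(x_{k−1} < w < x_{k+1})`** for an interior node (`0 < k < t`): each Christoffel number is at most the mass of the open interval between the neighbouring nodes.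
[Szegő §3.41 (3.41.4); this file, §1036] -/
theorem cms_weight_le_mass_between {t N : ℕ} {μ x : Fin (t + 1) → ℝ} {ν w : Fin N → ℝ} (hx : StrictMono x) (hν : ∀ l, 0 ≤ ν l)
    (hmom : ∀ p, p ≤ 2 * t → ∑ j, μ j * x j ^ p = ∑ l, ν l * w l ^ p) {a k b : Fin (t + 1)} (hak : (a : ℕ) + 1 = k) (hkb : (k : ℕ) + 1 = b) :
    μ k ≤ ∑ l ∈ Finset.univ.filter (fun l => x a < w l ∧ w l < x b), ν l := by
  have hab : a < b := Fin.lt_def.2 (by omega)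
  have h := cms_sum_weights_between_le_mass_between hx hν hmom hab
  have hk : ∑ j ∈ Finset.univ.filter (fun j => a < j ∧ j < b), μ j = μ k := by
    have hset : Finset.univ.filter (fun j : Fin (t + 1) => a < j ∧ j < b) = {k} := by
      ext j
      simp only [Finset.mem_filter, Finset.mem_univ, true_and, Finset.mem_singleton, Fin.lt_def, Fin.ext_iff]
      omega
    rw [hset, Finset.sum_singleton]
  rw [hk] at h
  exact h

end Summit.Ventures.HSemireg.Wedge.HankelOuter
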